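import Literature.AnabelianGeometry.SemiGraphs.Temperoids
import Literature.AnabelianGeometry.SemiGraphs.TemperoidsEpiProofs
import Literature.AnabelianGeometry.SemiGraphs.TemperoidsCountablyConnectedTransport
import Literature.AnabelianGeometry.SemiGraphs.TemperoidsProductDecomposition
import Literature.AlgebraicGeometry.Frobenioids.QuasiTemperoidConnected
import Literature.AnabelianGeometry.SemiGraphs.BTempCountablyConnectedProofs
import HarnessLib

/-!
# Semi-graphs of anabelioids, §3, Remark 3.1.5 — assembly: every temperoid is almost totally
# epimorphic; reduction of "of countably connected type" to `B^temp(Π)`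

Mochizuki, *Semi-graphs of anabelioids*, Publ. RIMS **42** (2006), §3, Remark 3.1.5 (manuscript
p. 34) [cite: MochizukiSemiAnbd2006, Rmk 3.1.5 p.34]: "It is immediate from the definitions that every
temperoid is an almost totally epimorphic category of countably connected type [cf. §0]."  The named
fact `TemperoidAlmostTotallyEpimorphic` of `Temperoids.lean` (abc-iut-L3-t2) is the conjunction of the
two properties for every `T ≌ ∏ᵢ B^temp(Πᵢ)`.  Assembling `TemperoidsEpiProofs` (one factor is almost
totally epimorphic), `TemperoidsProductLayer` / `TemperoidsProductDecomposition` (products) and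
`TemperoidsCountablyConnectedTransport` (equivalences), this proof-only file proves

* `TemperoidAlmostTotallyEpimorphic_part` — the FIRST conjunct unconditionally: every temperoid is
  almost totally epimorphic;
* `TemperoidAlmostTotallyEpimorphic_of_bTemp` — the whole named fact REDUCED to the single
  `B^temp(Π)`-level statement "`B^temp(Π)` is of countably connected type" (countable coproducts =
  disjoint unions, orbit decomposition; the import-of-record for it is abc-iut-L3-t5's
  `BTempStructureProofs.lean`, cell ruling 2026-08-25T20:08:33Z), labelled a REDUCTION, not a
  discharge.

No definitions; nothing here takes a side on [IUTchIII] Cor. 3.12.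
-/

namespace Literature.AnabelianGeometry.SemiGraphs

open CategoryTheory CategoryTheory.Limits
open Literature.AlgebraicGeometry.Frobenioids
open Literature.AlgebraicGeometry.Frobenioids.QuasiTemperoid.BTempConnected

universe v₁ u u₁

namespace BTemp

variable {G : Type u} [Group G] [TopologicalSpace G]

/-- Initial objects of `B^temp(Π)` are strict: a morphism out of a non-initial object (= an object with
a point) has non-initial target. [cite: MochizukiSemiAnbd2006, Rmk 3.1.5 p.34] -/
theorem isNonemptyObj_of_hom {A B : BTemp G} (f : A ⟶ B) (hA : IsNonemptyObj A) :
    IsNonemptyObj B := by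
  obtain ⟨x⟩ := nonempty_of_isNonemptyObj A hA
  exact isNonemptyObj_of_nonempty B (f.hom.hom x)

variable (G) in
/-- `B^temp(Π)` has an initial object (the empty `Π`-set). [cite: MochizukiSemiAnbd2006, Rmk 3.1.5 p.34] -/
theorem hasInitial : HasInitial (BTemp G) := by
  let E : BTemp G := ⟨{ V := PEmpty.{u + 1}, ρ := 1 }, ⟨inferInstance, fun (z : PEmpty) => z.elim⟩⟩
  exact (isInitial_of_isEmpty E (inferInstanceAs (IsEmpty PEmpty))).some.hasInitial

end BTemp

/-- **[SemiAnbd] Remark 3.1.5, first conjunct: every temperoid is an almost totally epimorphic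
category.** (A temperoid is equivalent to `∏ᵢ B^temp(Πᵢ)`; each factor is almost totally epimorphic
with strict initial objects; products and equivalences preserve the property.)
[cite: MochizukiSemiAnbd2006, Rmk 3.1.5 p.34] -/
theorem TemperoidAlmostTotallyEpimorphic_part (T : Type u₁) [Category.{v₁} T]
    (hT : IsTemperoid.{v₁, u, u₁} T) : IsAlmostTotallyEpimorphic T := by
  obtain ⟨𝒯⟩ := hT
  haveI : ∀ i, HasInitial (BTemp (𝒯.G i)) := fun i => BTemp.hasInitial (𝒯.G i)
  exact TemperoidTransport.isAlmostTotallyEpimorphic_of_equivalence 𝒯.equiv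
    (TemperoidProduct.isAlmostTotallyEpimorphic_pi
      (fun i _ _ f h => BTemp.isNonemptyObj_of_hom f h)
      fun i => BTemp.isAlmostTotallyEpimorphic (𝒯.G i))

/-- **[SemiAnbd] Remark 3.1.5 — REDUCTION (not a discharge)**: the named fact
`TemperoidAlmostTotallyEpimorphic` ("every temperoid is an almost totally epimorphic category of
countably connected type") follows from the single `B^temp(Π)`-level statement that `B^temp(Π)` is of
countably connected type for every tempered `Π`. [cite: MochizukiSemiAnbd2006, Rmk 3.1.5 p.34] -/
theorem TemperoidAlmostTotallyEpimorphic_of_bTemp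
    (hB : ∀ (G : Type u) [Group G] [TopologicalSpace G] [IsTopologicalGroup G],
      IsTempered G → IsOfCountablyConnectedType (BTemp G)) :
    TemperoidAlmostTotallyEpimorphic.{v₁, u, u₁} := by
  intro T _ hT
  refine ⟨TemperoidAlmostTotallyEpimorphic_part T hT, ?_⟩
  obtain ⟨𝒯⟩ := hT
  haveI : Countable 𝒯.ι := 𝒯.countable
  exact TemperoidTransport.isOfCountablyConnectedType_of_equivalence 𝒯.equiv
    (TemperoidProduct.isOfCountablyConnectedType_pi
      (fun i _ _ f h => BTemp.isNonemptyObj_of_hom f h)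
      fun i => hB (𝒯.G i) (𝒯.isTempered i))

/-- **[SemiAnbd] Remark 3.1.5 — DISCHARGE of the named fact `TemperoidAlmostTotallyEpimorphic` of
`Temperoids.lean`**: "every temperoid is an almost totally epimorphic category of countably connected
type".  The reduction `TemperoidAlmostTotallyEpimorphic_of_bTemp` applied to abc-iut-L3-t5's
`BTemp.isOfCountablyConnectedType` (`BTempCountablyConnectedProofs.lean`: countable coproducts in
`B^temp(Π)` are disjoint unions; every object is the coproduct of its orbits).
[cite: MochizukiSemiAnbd2006, Rmk 3.1.5 p.34] -/
theorem TemperoidAlmostTotallyEpimorphic_holds : TemperoidAlmostTotallyEpimorphic.{v₁, u, u₁} :=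
  TemperoidAlmostTotallyEpimorphic_of_bTemp fun G _ _ _ _ => BTemp.isOfCountablyConnectedType (G := G)

end Literature.AnabelianGeometry.SemiGraphs
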